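import Summits.BirchSwinnertonDyer.BirchSwinnertonDyer.Theorems.ClassRecordThreeHsiehDescentUnramifiedPeriod
import HarnessLib

/-!
# The `R₀`-descent of Hsieh's anticyclotomic `p`-adic `L`-function at EVERY odd prime `p ∣ N`:
# an `R₀`-frame with Castella's interpolation property (`IsBDPLFunction`) from Hsieh 2014 (period in
# `𝒲^×`) and Bertolini–Darmon–Prasanna 2013 central-value reciprocity — the general-`p` port of the
# cell's `p = 3` chain (crux `HsiehDescentAtThree`, seat desc3-p1)

Cell `bsd-stepL` (run/shared/lean/pub/bsd-stepL/), seat `bsd-stepL-nram2` (prover g2, PART 1b residue fan-out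
row (5)), `--supports stmt-BirchSwinnertonDyer-19282` (crux `OpenInputNotRam` of route `ErratumRoadFive`; the
consumer is the registered stub `stub_bdpDatumNotRam` = H1′ "an `R₀`-frame EXISTS at `p ∥ N`" on the (¬ram) pairs,
landed by g0 on the SEMISTABLE pairs only from Castella 2018 Thm. 3.1, which stands under «square-free `N`»,
arXiv:1704.06608 p. 9). On the NON-semistable pairs the `Λ_{R₀}`-membership of the BDP `p`-adic `L`-function at
`p ∥ N` is not a refereed statement (Castella 2020 JIMJ Def. 1.3 ∕ Thm. 4.4: a `𝒲`-valued function, `𝒲` finite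
over `ℤ̂_p^nr`, `p ∤ h_K`; Castella JIMJ 17 (2018) Thm. 2.10: continuity; Castella 2024 §2.3: preprint one-liner).
THIS FILE MAKES IT A THEOREM OF THE TREE modulo two refereed named facts, at every odd `p ∣ N`, by DESCENT.

THE ARGUMENT = desc3-p1's `hsiehDescentAt₃_of_inertialReciprocity_of_unrPeriodWitness`, steps 0–10, with `3 ↦ p` (every
engine lemma it calls — x11b3's `X11b/Three/HsiehDescent{ValuesUnderGalois,Inertia,FamilyTwist,Twist,Period}`,
`Theorems/ClassRecordThreeHsiehDescentFiniteOrbit`, `X11b/PadicComplexTransport`, `X11b.exists_interpolationCharacter` — is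
stated at a general prime): normalise the `R₀`-period Hsieh witness to `E = ι′⁻¹(C)⁻¹·Q` (values `θⁿ·ι′⁻¹V(χ)`,
`θ = ι′⁻¹((p/16A²)(Ω/Ω_K)⁴)·Ω_p⁴`, `V = bdpInterpolationValue p f 𝔭 · · Ω`); inertial value reciprocity along a base
family gives twist relations `T_τĒ = (1+T)^{a(τ)}Ē` for inertial `τ`; `T_τ` fixes `Ω_p ∈ R₀` and a power of `τ` fixes
the algebraic `ι′⁻¹((p/16A²)(Ω/Ω_K)⁴)`, hence `θ`, hence `Ē`, so `a ≡ 0` on inertia (finite orbits, NO Tate–Sen) and the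
coefficients of `E` lie in `R₀`; `θⁿ = (βr⁴)ⁿ` on the types with a non-zero value (`β ∈ ℚ̄_p`, `r ∈ R₀ˣ`), and the
complex period `Ω/ρ`, `ρ⁴ = ι′β`, writes the values in Castella's display (`bdpInterpolationValue_eq_mul_of_ne_zero`).

* `exists_isBDPLFunction_of_inertialReciprocity_of_unrPeriodWitness` — THE DESCENT at every odd `p ∣ N` (this file's
  one theorem; hypotheses = ONE `R₀`-period Hsieh witness + inertial value reciprocity, both explicit).
* Sequel `ErratumRoadFiveOpenInputNotRamBDPFrameDescentStub`: inertial value reciprocity from the named fact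
  `bertoliniDarmonPrasanna2013_centralValue_reciprocity` (desc3's `openValueReciprocityAtThree_of_archimedeanReciprocity`,
  `3 ↦ p`), the frame at every classical datum from the two named facts + `X11b.lambdaSupplyAt`, and the registered stub
  `stub_bdpDatumNotRam` of crux 19282 on ALL (¬ram) pairs.

HONEST FRAMING: an UNCONDITIONAL theorem whose two displayed hypotheses are, in the sequel, fed by two refereed named
facts (Hsieh 2014 Thm. 5.6 with the Katz–Hida–Tilouine period `Ω_p ∈ 𝒲^×`; BDP13 Thm. 5.5 ∕ (5.1.16)); no definition,
no named fact, no `sorry`; nothing is booked; BSD is not proved for any class; X11b stays CONSTRUCTION-SHAPED. What this is NOT: not a statement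
about THE `L_p(f)` of Castella (the frame is ∃-quantified, as in A206), not the value at `𝟙`, not (2.4).

References: [Hsieh2014] M.-L. Hsieh, Doc. Math. 19 (2014), Thm. 1 ∕ Thm. 5.6 (arXiv:1112.1580 pp. 3–4, 23);
[CastellaHsieh2018] §2.5 (arXiv:1505.08165 p. 7); [BertoliniDarmonPrasanna2013] Thm. 5.5, (5.1.16), Prop. 1.12 (1),
Lemma 5.3; [Castella2018] Thm. 3.1 (arXiv:1704.06608 p. 9); [SerreLocalFields1979] Ch. IV §4; [Washington1997] §5.1;
tree: desc3-p1 `Theorems/ClassRecordThreeHsiehDescentUnramifiedPeriod.lean`, `…OpenValueReciprocityOfArchimedean.lean`.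
-/

noncomputable section

set_option linter.dupNamespace false

open scoped NumberField Topology
open Filter NumberField IsDedekindDomain Field PowerSeries WeierstrassCurve
open Literature.NumberTheory.GaloisRepresentations Literature.NumberTheory.EllipticCurves
open Literature.NumberTheory.EllipticCurves.ModularForms
open Summit.BirchSwinnertonDyer.Rank1Residual Summit.BirchSwinnertonDyer.Rank1Residual.X11b
open Summit.BirchSwinnertonDyer.Rank1Residual.X11b.Three Summit.BirchSwinnertonDyer.Rank1Residual.X11b.LambdaSupply
open Summit.BirchSwinnertonDyer.Rank1Residual.X11b.Three.LambdaSupply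
open Summit.BirchSwinnertonDyer.Rank1Residual.X11b.PadicComplexTransport (continuous_algEquiv
  mem_unrIntegers_of_forall_inertia_fixed_family mem_fracUnr_of_forall_inertia_fixed_family)
open Summit.BirchSwinnertonDyer.Rank1Residual.X11b.Three.RangeTransport

namespace Summit.BirchSwinnertonDyer.BirchSwinnertonDyer.Theorems

/-! ### The descent at every odd `p ∣ N` -/

section Core

/-- **THE `R₀`-DESCENT at every odd prime `p ∣ N`.** Data: `ι′ : ℚ̄_p ≃ ℂ`; `K` imaginary quadratic; a prime
`𝔭 ∋ p` of `K` of residue degree and ramification index one; `κ` anticyclotomic with topological generator `γ`;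
`f ∈ S_2(Γ₀(N))` with `p ∣ N`; ONE Hsieh witness `(A, Ω_K, C, Ω_p, Q)` with `Ω_p ∈ R₀ˣ` (`IsHsiehLFunction`, Hsieh 2014
Thm. 5.6 with the Katz–Hida–Tilouine period in `𝒲^×`); and a complex period `Ω ≠ 0` at which Castella's
interpolation value is INERTIALLY RECIPROCAL (sequel file, from BDP13). Conclusion: an `R₀`-frame `(Ω_K′ ≠ 0, Ω_p′ ∈ R₀ˣ, L ∈ R₀⟦T⟧)`
with `IsBDPLFunction ι′ 𝔭 κ γ f Ω_K′ Ω_p′ L` (module docstring; finite Galois orbits, no Tate–Sen).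
[cite: Hsieh2014, Thm. 1 and Thm. 5.6 (arXiv:1112.1580 pp. 3–4, 23)] [cite: CastellaHsieh2018, §2.5 (arXiv:1505.08165 p. 7)]
[cite: Castella2018, Thm. 3.1 (arXiv:1704.06608 p. 9)] [cite: Washington1997, §5.1] -/
theorem exists_isBDPLFunction_of_inertialReciprocity_of_unrPeriodWitness
    {p : ℕ} [Fact p.Prime] (hp2 : p ≠ 2) (ι' : PadicAlgCl p ≃+* ℂ) {K : Type} [Field K] [NumberField K]
    {𝔭 : HeightOneSpectrum (𝓞 K)} {κ : ZpExtension K p} {γ : Field.absoluteGaloisGroup K}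
    {N : ℕ} {f : CuspForm (CongruenceSubgroup.Gamma0 N) 2} (hpN : p ∣ N) (hKiq : IsImaginaryQuadratic K)
    (hp𝔭 : ((p : ℕ) : 𝓞 K) ∈ 𝔭.asIdeal) (hram : 𝔭.asIdeal.ramificationIdx (𝓞 ℚ) = 1)
    (hdeg : 𝔭.asIdeal.inertiaDeg (𝓞 ℚ) = 1) (hκa : κ.IsAnticyclotomic) (hγ : κ.IsTopGenerator γ)
    {A : ℝ} {ΩK C : ℂ} (Ωpu : (unrIntegers p)ˣ) {Q : PowerSeries (PadicComplexInt p)}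
    (hA : 0 < A) (hΩK : ΩK ≠ 0) (hC : ‖((ι'.symm C : PadicAlgCl p) : ℂ_[p])‖ = 1)
    (hQ : IsHsiehLFunction ι' 𝔭 κ γ f A ΩK C ((Ωpu : unrIntegers p) : ℂ_[p]) Q)
    {Ω : ℂ} (hΩ : Ω ≠ 0)
    (hVRB : ∀ (τ : PadicAlgCl p ≃ₐ[ℚ_[p]] PadicAlgCl p) (σ : ℂ ≃ₐ[ℚ] ℂ),
      (∀ ζ : PadicAlgCl p, (∃ m : ℕ, 0 < m ∧ ¬ p ∣ m ∧ ζ ^ m = 1) → τ ζ = ζ) →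
      (∀ z : PadicAlgCl p, σ (ι' z) = ι' (τ z)) →
      ∀ (χ : HeckeCharacter K) (n : ℕ), 0 < n →
        (∀ v : HeightOneSpectrum (𝓞 K), χ.IsUnramifiedAt v) →
        ∀ hχ : χ.HasInfinityType (fun _ ↦ (n : ℤ)) (fun _ ↦ -(n : ℤ)),
          σ (bdpInterpolationValue p f 𝔭 χ n Ω) = bdpInterpolationValue p f 𝔭 (hχ.autConj σ) n Ω) :
    ∃ (ΩK' : ℂ) (Ωp' : (unrIntegers p)ˣ) (L : UnrSeries p), ΩK' ≠ 0 ∧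
      IsBDPLFunction ι' 𝔭 κ γ f ΩK' ((Ωp' : unrIntegers p) : ℂ_[p]) L := by
  have hp : p.Prime := Fact.out
  haveI := Literature.NumberTheory.GaloisRepresentations.Padic.isNonarchimedeanLocalField_holds p
  -- ## 0. The `R₀`-period witness
  set Ωp : ℂ_[p] := ((Ωpu : unrIntegers p) : ℂ_[p])
  have hΩpmem : Ωp ∈ unrIntegers p := (Ωpu : unrIntegers p).2
  have hΩp : ‖Ωp‖ = 1 := (unrIntegers.isUnit_iff_norm_eq_one _).1 Ωpu.isUnit
  have hKreal : ∀ w : InfinitePlace K, ¬ w.IsReal := not_isReal_of_isImaginaryQuadratic hKiq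
  have hK2 : Module.finrank ℚ K = 2 := hKiq.1
  set CC : ℂ_[p] := ((ι'.symm C : PadicAlgCl p) : ℂ_[p]) with hCC
  have hCC0 : CC ≠ 0 := fun h ↦ by rw [h, norm_zero] at hC; exact zero_ne_one hC
  have hA' : (A : ℂ) ≠ 0 := by exact_mod_cast hA.ne'
  have hΘ0 : ((((p : ℕ) : ℂ) / (16 * (A : ℂ) ^ 2)) * (Ω / ΩK) ^ 4) ≠ 0 :=
    mul_ne_zero (div_ne_zero (Nat.cast_ne_zero.mpr hp.ne_zero)
      (mul_ne_zero (by norm_num) (pow_ne_zero 2 hA'))) (pow_ne_zero 4 (div_ne_zero hΩ hΩK))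
  set z : PadicAlgCl p := ι'.symm ((((p : ℕ) : ℂ) / (16 * (A : ℂ) ^ 2)) * (Ω / ΩK) ^ 4) with hzdef
  set θ : ℂ_[p] := ((z : PadicAlgCl p) : ℂ_[p]) * Ωp ^ 4 with hθ
  have hΩp0 : Ωp ≠ 0 := fun h ↦ by rw [h, norm_zero] at hΩp; exact zero_ne_one hΩp
  have hθ0 : θ ≠ 0 := by
    refine mul_ne_zero ?_ (pow_ne_zero 4 hΩp0)
    rw [PadicComplex.coe_eq, map_ne_zero_iff _ (algebraMap (PadicAlgCl p) ℂ_[p]).injective,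
      map_ne_zero_iff _ ι'.symm.injective]
    exact hΘ0
  -- ## 1. The extensions `T_τ`, their coefficient maps, and `σ_τ = ι′ τ ι′⁻¹`
  choose T hT hTτ using fun τ : PadicAlgCl p ≃ₐ[ℚ_[p]] PadicAlgCl p ↦ exists_continuous_extension τ
  choose φ hφ using fun τ : PadicAlgCl p ≃ₐ[ℚ_[p]] PadicAlgCl p ↦
    exists_restrict_padicComplexInt (hT τ) (hTτ τ)
  have hσex : ∀ τ : PadicAlgCl p ≃ₐ[ℚ_[p]] PadicAlgCl p, ∃ σ : ℂ ≃ₐ[ℚ] ℂ,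
      ∀ z, σ (ι' z) = ι' (τ z) := fun τ ↦ by
    obtain ⟨σ, hσ⟩ := exists_algEquiv_eq_ringEquiv
      (ι'.symm.trans ((τ : PadicAlgCl p ≃+* PadicAlgCl p).trans ι'))
    exact ⟨σ, fun z ↦ by rw [hσ]; simp⟩
  choose σ hστ using hσex
  have hσK : ∀ τ (φ' : K →+* ℂ) (k : K), σ τ (φ' k) = φ' k := by
    intro τ φ' k
    have h1 := algEquiv_apply_embedding_eq hK2 (embAt K p 𝔭 hp𝔭 hram hdeg) τ
      (ι'.symm.toRingHom.comp φ') k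
    have h2 := hστ τ (ι'.symm (φ' k))
    rw [ι'.apply_symm_apply] at h2
    rw [h2]
    change ι' (τ (ι'.symm (φ' k))) = φ' k
    rw [show τ (ι'.symm (φ' k)) = ι'.symm (φ' k) from h1, ι'.apply_symm_apply]
  have hTΩp : ∀ τ, (∀ ζ : PadicAlgCl p, (∃ m : ℕ, 0 < m ∧ ¬ p ∣ m ∧ ζ ^ m = 1) → τ ζ = ζ) →
      T τ Ωp = Ωp := fun τ hτ ↦ extension_apply_eq_of_mem_unrIntegers hτ (hT τ) (hTτ τ) hΩpmem
  -- ## 2. A base range point with `‖u − 1‖ < 1/p`, `u ≠ 1`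
  obtain ⟨χ₀, m₀, ψ₀, hm₀, hunr₀, hχ₀, hav₀, hfac₀, hlt₀, hne₀⟩ :=
    exists_interpolationCharacter (p := p) hp2 ι' K κ hKiq hκa γ hγ
  rw [avatarValueAt_unitsChar] at hlt₀
  simp_rw [avatarValueAt_unitsChar] at hne₀
  obtain ⟨k, hk⟩ : ∃ k : ℕ,
      ‖(((ψ₀ γ : (PadicAlgCl p)ˣ) : PadicAlgCl p) : ℂ_[p]) ^ p ^ k - 1‖ < ((p : ℕ) : ℝ)⁻¹ := by
    have ht := (tendsto_pow_prime_pow_padicComplex (p := p) hlt₀).sub_const 1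
    rw [sub_self] at ht
    have hev := (Metric.tendsto_nhds.1 ht) _ (inv_pos.mpr (Nat.cast_pos.mpr hp.pos) : (0 : ℝ) < ((p : ℕ) : ℝ)⁻¹)
    obtain ⟨k, hk⟩ := hev.exists
    exact ⟨k, by simpa only [dist_zero_right] using hk⟩
  have hn₁ : 0 < p ^ k * m₀ := Nat.mul_pos (pow_pos hp.pos k) hm₀
  have hunr₁ : ∀ v : HeightOneSpectrum (𝓞 K), (χ₀ ^ p ^ k).IsUnramifiedAt v :=
    fun v ↦ isUnramifiedAt_pow' (hunr₀ v) _
  have hχ₁ := hasInfinityType_pow_range hχ₀ (p ^ k)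
  have hav₁ := isPAdicAvatarOf_pow ι' hav₀ (fun v _ ↦ hunr₀ v) (p ^ k)
  have hfac₁ := factorsThroughZp_unitsChar_pow κ hfac₀ (p ^ k)
  have hψ₁γ : (((ψ₀ ^ p ^ k) γ : (PadicAlgCl p)ˣ) : PadicAlgCl p) =
      ((ψ₀ γ : (PadicAlgCl p)ˣ) : PadicAlgCl p) ^ p ^ k := by
    rw [ContinuousMonoidHom.pow_apply, Units.val_pow_eq_pow_val]
  have hu : ‖((((ψ₀ ^ p ^ k) γ : (PadicAlgCl p)ˣ) : PadicAlgCl p) : ℂ_[p]) - 1‖ < ((p : ℕ) : ℝ)⁻¹ := by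
    rw [hψ₁γ, PadicComplex.coe_eq, map_pow, ← PadicComplex.coe_eq]; exact hk
  have hu1 : (((ψ₀ ^ p ^ k) γ : (PadicAlgCl p)ˣ) : PadicAlgCl p) ≠ 1 := by
    rw [hψ₁γ]
    intro h
    apply hne₀ k
    rw [PadicComplex.coe_eq, ← map_pow, h, map_one]
  -- ## 3. The degenerate witness `Q = 0`
  by_cases hQ0 : Q = 0
  · refine ⟨Ω, 1, 0, hΩ, fun χ n hn hunr hχ r hr hκr ↦ ?_⟩
    have hv := hQ χ n hn hunr hχ r hr hκr
    rw [hQ0] at hv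
    have hval := (intSeries_hasValueAt_zero_series (p := p) (avatarValueAt r γ - 1)).unique hv
    rw [hsiehInterpolationValue_eq_mul_pow_mul hpN f 𝔭 χ n A ΩK C hΩ] at hval
    have hB0 : bdpInterpolationValue p f 𝔭 χ n Ω = 0 := by
      have h4n : 4 * n ≠ 0 := by omega
      rcases mul_eq_zero.1 hval.symm with h | h
      · rw [PadicComplex.coe_eq, map_eq_zero_iff _ (algebraMap (PadicAlgCl p) ℂ_[p]).injective,
          map_eq_zero_iff _ ι'.symm.injective] at h
        rcases mul_eq_zero.1 h with h' | h'
        · rcases mul_eq_zero.1 h' with h'' | h''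
          · exact absurd h'' fun hC0 ↦ hCC0 (by rw [hCC, hC0, map_zero]; rfl)
          · exact absurd h'' (pow_ne_zero n hΘ0)
        · exact h'
      · exact absurd ((pow_eq_zero_iff h4n).1 h) hΩp0
    rw [hB0, map_zero]
    unfold UnrSeries.HasValueAt
    simp
  -- ## 4. The normalised series `E = ι′⁻¹(C)⁻¹ · Q`
  have hCinv : ‖CC⁻¹‖ ≤ 1 := by rw [norm_inv, hC, inv_one]
  set c₀ : 𝓞_ℂ_[p] := ⟨CC⁻¹, Literature.NumberTheory.LFunctions.Dwork.mem_unitBall.2 hCinv⟩ with hc₀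
  have hc₀c : ((c₀ : 𝓞_ℂ_[p]) : ℂ_[p]) = CC⁻¹ := rfl
  set E : PowerSeries 𝓞_ℂ_[p] := PowerSeries.C c₀ * Q with hEdef
  have hE : ∀ k', ((coeff k' E : 𝓞_ℂ_[p]) : ℂ_[p]) = CC⁻¹ * ((coeff k' Q : 𝓞_ℂ_[p]) : ℂ_[p]) :=
    fun k' ↦ by rw [hEdef, coeff_C_mul, MulMemClass.coe_mul, hc₀c]
  have hE0 : E ≠ 0 := by
    intro h0
    apply hQ0
    have hc : PowerSeries.C c₀ ≠ 0 := by
      intro h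
      have : ((c₀ : 𝓞_ℂ_[p]) : ℂ_[p]) = 0 := by
        have := congrArg constantCoeff h
        rw [constantCoeff_C, map_zero] at this
        rw [this]; rfl
      exact inv_ne_zero hCC0 (hc₀c ▸ this)
    exact (mul_eq_zero.1 h0).resolve_left hc
  have hEval : ∀ (χ : HeckeCharacter K) (n : ℕ), 0 < n →
      (∀ v : HeightOneSpectrum (𝓞 K), χ.IsUnramifiedAt v) →
      χ.HasInfinityType (fun _ ↦ (n : ℤ)) (fun _ ↦ -(n : ℤ)) →
      ∀ r : FramedGaloisRep K (PadicAlgCl p) 1, IsPAdicAvatarOf ι' χ r → FactorsThroughZp κ r →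
        IntSeries.HasValueAt E (avatarValueAt r γ - 1)
          (θ ^ n * ((ι'.symm (bdpInterpolationValue p f 𝔭 χ n Ω) : PadicAlgCl p) : ℂ_[p])) := by
    intro χ n hn hunr hχ r hr hκr
    have h := hasValueAt_of_coeff_eq_mul hE (hasValueAt_normalForm ι' hQ hpN hΩ hn hunr hχ hr hκr)
    rw [← hzdef, ← hθ, ← hCC, ← mul_assoc, ← mul_assoc, inv_mul_cancel₀ hCC0, one_mul] at h
    exact h
  -- ## 5′. The twist relations `T_τ Ē = (1+T)^{a′_τ} Ē` for INERTIAL `τ` (exactness in family form)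
  have h1 : ((ι'.symm (1 : ℂ) : PadicAlgCl p) : ℂ_[p]) = 1 := by rw [map_one]; rfl
  have hV1 : ∀ τ : PadicAlgCl p ≃ₐ[ℚ_[p]] PadicAlgCl p,
      (∀ ζ : PadicAlgCl p, (∃ m : ℕ, 0 < m ∧ ¬ p ∣ m ∧ ζ ^ m = 1) → τ ζ = ζ) →
      ∀ j : ℕ, 0 < j →
        σ τ (bdpInterpolationValue p f 𝔭 ((χ₀ ^ p ^ k) ^ j) (j * (p ^ k * m₀)) Ω) =
          1 * 1 ^ (j * (p ^ k * m₀)) * ((0 : HeightOneSpectrum (𝓞 K) →₀ ℤ).prod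
            fun v k' ↦ ((hasInfinityType_pow_range hχ₁ j).autConj (σ τ)).valueAtUniformizer v ^ k') *
            bdpInterpolationValue p f 𝔭 ((hasInfinityType_pow_range hχ₁ j).autConj (σ τ))
              (j * (p ^ k * m₀)) Ω := by
    intro τ hτ j hj
    rw [Finsupp.prod_zero_index, hVRB τ (σ τ) hτ (hστ τ) _ _ (Nat.mul_pos hj hn₁)
      (fun v ↦ isUnramifiedAt_pow' (hunr₁ v) j) (hasInfinityType_pow_range hχ₁ j)]
    ring
  have key : ∀ τ : PadicAlgCl p ≃ₐ[ℚ_[p]] PadicAlgCl p, ∃ a' : ℤ_[p],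
      (∀ ζ : PadicAlgCl p, (∃ m : ℕ, 0 < m ∧ ¬ p ∣ m ∧ ζ ^ m = 1) → τ ζ = ζ) →
      (E.map (PadicComplexInt p).subtype).map (T τ) =
        PowerSeries.C (1 : ℂ_[p]) *
          ((((binomialSeries ℤ_[p] a').map (R1.toCpInt p)) * E).map (PadicComplexInt p).subtype) := by
    intro τ
    by_cases hτ : ∀ ζ : PadicAlgCl p, (∃ m : ℕ, 0 < m ∧ ¬ p ∣ m ∧ ζ ^ m = 1) → τ ζ = ζ
    · obtain ⟨a', ha'⟩ := exists_twist_of_family ι' hQ hpN hΩ hθ0 hCC0 hKreal (hT τ) (hTτ τ) (hφ τ)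
        (hστ τ) (hσK τ) one_ne_zero one_ne_zero hn₁ hunr₁ hχ₁ (hV1 τ hτ) hav₁ hfac₁ hu hu1 hE0 hE
      rw [h1] at ha'
      exact ⟨a', fun _ ↦ ha'⟩
    · exact ⟨0, fun h ↦ absurd h hτ⟩
  choose a ha using key
  -- ## 5″. NO Tate–Sen: `τ^{k+1}` fixes the algebraic `z`, `τ̂^{k+1}` fixes `Ω_p ∈ R₀`, so `θ`, so `Ē`; finite order
  have hfixpow : ∀ τ : PadicAlgCl p ≃ₐ[ℚ_[p]] PadicAlgCl p,
      (∀ ζ : PadicAlgCl p, (∃ m : ℕ, 0 < m ∧ ¬ p ∣ m ∧ ζ ^ m = 1) → τ ζ = ζ) →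
      ∃ k' : ℕ, (E.map (PadicComplexInt p).subtype).map (T (τ ^ (k' + 1))) =
        E.map (PadicComplexInt p).subtype := by
    intro τ hτ
    obtain ⟨j', hj', hjz⟩ := exists_pos_pow_apply_eq τ z
    obtain ⟨k', rfl⟩ : ∃ k' : ℕ, j' = k' + 1 := ⟨j' - 1, (Nat.sub_add_cancel hj').symm⟩
    have hτk := inertial_pow hτ (k' + 1)
    have hTθ : T (τ ^ (k' + 1)) θ = θ := by
      rw [hθ, map_mul, map_pow, hTτ, hjz, hTΩp _ hτk]
    refine ⟨k', ?_⟩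
    rw [← map_map_restrict (hφ (τ ^ (k' + 1))),
      map_restrict_eq_self_of_extension_apply_period_eq ι' hQ hpN hΩ hθ0 hCC0 hKreal (hT _) (hTτ _) (hφ _)
        (hστ _) (hσK _) hn₁ hunr₁ hχ₁ (hV1 _ hτk) hav₁ hfac₁ hu hu1 hE hTθ]
  have hI : ∀ τ : PadicAlgCl p ≃ₐ[ℚ_[p]] PadicAlgCl p,
      (∀ ζ : PadicAlgCl p, (∃ k : ℕ, 0 < k ∧ ¬ p ∣ k ∧ ζ ^ k = 1) → τ ζ = ζ) → a τ = 0 :=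
    twistExponent_eq_zero_on_inertia_of_fixed_pow T hT hTτ hE0 ha hfixpow
  have hfix : ∀ τ, (∀ ζ : PadicAlgCl p, (∃ m : ℕ, 0 < m ∧ ¬ p ∣ m ∧ ζ ^ m = 1) → τ ζ = ζ) →
      (E.map (PadicComplexInt p).subtype).map (T τ) = E.map (PadicComplexInt p).subtype := by
    intro τ hτ
    rw [ha τ hτ, hI τ hτ, binomialSeries_zero, map_one, one_mul, map_one, one_mul]
  -- ## 7. The coefficients of `E` lie in `R₀`: the series `L`
  have hcoefR : ∀ k', ((coeff k' E : 𝓞_ℂ_[p]) : ℂ_[p]) ∈ unrIntegers p := fun k' ↦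
    mem_unrIntegers_of_forall_inertia_fixed_family p T hT hTτ _
      (R1.norm_coe_padicComplexInt_le_one p _) fun τ hτ ↦ by
        have h := congrArg (coeff k') (hfix τ hτ)
        simpa only [coeff_map, ValuationSubring.subtype_apply] using h
  set L : UnrSeries p := PowerSeries.mk fun k' ↦ (⟨_, hcoefR k'⟩ : unrIntegers p) with hL
  have hLE : ∀ k', ((coeff k' E : 𝓞_ℂ_[p]) : ℂ_[p]) = ((coeff k' L : unrIntegers p) : ℂ_[p]) :=
    fun k' ↦ by rw [hL, coeff_mk]
  -- ## 8. `(T_τ θ)^n = θ^n` on inertia whenever a value of type `n` is non-zero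
  set S : Set ℕ := {n | ∃ (χ : HeckeCharacter K) (r : FramedGaloisRep K (PadicAlgCl p) 1), 0 < n ∧
    (∀ v : HeightOneSpectrum (𝓞 K), χ.IsUnramifiedAt v) ∧
    χ.HasInfinityType (fun _ ↦ (n : ℤ)) (fun _ ↦ -(n : ℤ)) ∧ IsPAdicAvatarOf ι' χ r ∧
    FactorsThroughZp κ r ∧ bdpInterpolationValue p f 𝔭 χ n Ω ≠ 0} with hS
  have hθS : ∀ τ, (∀ ζ : PadicAlgCl p, (∃ m : ℕ, 0 < m ∧ ¬ p ∣ m ∧ ζ ^ m = 1) → τ ζ = ζ) →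
      ∀ n ∈ S, (T τ θ) ^ n = θ ^ n := by
    rintro τ hτ n ⟨χ, r, hn, hunr, hχ, hr, hκr, hB⟩
    -- `r = e₁ ∘ ψ`
    set e₁ := (FramedRep.unitsContinuousMulEquivOfUnique (Fin 1) (PadicAlgCl p) :
      (PadicAlgCl p)ˣ →ₜ* GL (Fin 1) (PadicAlgCl p)) with he₁
    set ψ : absoluteGaloisGroup K →ₜ* (PadicAlgCl p)ˣ :=
      ((FramedRep.unitsContinuousMulEquivOfUnique (Fin 1) (PadicAlgCl p)).symm :
        GL (Fin 1) (PadicAlgCl p) →ₜ* (PadicAlgCl p)ˣ).comp r with hψ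
    have hre : e₁.comp ψ = r := by rw [he₁, hψ, comp_symm_comp_eq]
    rw [← hre] at hr hκr
    have hτc : Continuous (τ : PadicAlgCl p ≃+* PadicAlgCl p) := continuous_algEquiv τ
    -- the transported range point and its value
    have hunr' : ∀ v : HeightOneSpectrum (𝓞 K), (hχ.autConj (σ τ)).IsUnramifiedAt v :=
      fun v ↦ (hχ.isUnramifiedAt_autConj_iff (σ τ) v).mpr (hunr v)
    have hinf' := hasInfinityType_autConj_of_forall_apply_eq hχ (σ τ) (hσK τ) hKreal
    have hav' := isPAdicAvatarOf_autConj_unitsChar ι' _ hτc (σ τ) (hστ τ) hχ hr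
    have hfac' := factorsThroughZp_map_unitsChar _ hτc κ hκr
    have hv' := hEval _ n hn hunr' hinf' _ hav' hfac'
    rw [avatarValueAt_map_unitsChar _ hτc ψ γ] at hv'
    -- the value at the original point, moved by `T_τ`
    have hv := hEval χ n hn hunr hχ _ hr hκr
    rw [avatarValueAt_unitsChar] at hv
    have hmoved := hasValueAt_map_extension (hT τ) (hφ τ) hv
    have hEφ : E.map (φ τ) = E := by
      apply map_injective (PadicComplexInt p).subtype Subtype.coe_injective
      rw [map_map_restrict (hφ τ), hfix τ hτ]
    rw [hEφ, map_sub, map_one, hTτ, map_mul, map_pow,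
      extension_coe_symm ι' (hTτ τ) (σ τ) (hστ τ), hVRB τ (σ τ) hτ (hστ τ) χ n hn hunr hχ]
      at hmoved
    have heq := hmoved.unique hv'
    have hB' : ((ι'.symm (bdpInterpolationValue p f 𝔭 (hχ.autConj (σ τ)) n Ω) : PadicAlgCl p) :
        ℂ_[p]) ≠ 0 := by
      rw [← hVRB τ (σ τ) hτ (hστ τ) χ n hn hunr hχ, PadicComplex.coe_eq,
        map_ne_zero_iff _ (algebraMap (PadicAlgCl p) ℂ_[p]).injective,
        map_ne_zero_iff _ ι'.symm.injective, map_ne_zero_iff _ (σ τ).injective]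
      exact hB
    exact mul_right_cancel₀ hB' heq
  obtain ⟨g, hgS, hgmem⟩ := exists_nat_generator S
  have hθg : ∀ τ, (∀ ζ : PadicAlgCl p, (∃ m : ℕ, 0 < m ∧ ¬ p ∣ m ∧ ζ ^ m = 1) → τ ζ = ζ) →
      T τ (θ ^ g) = θ ^ g := fun τ hτ ↦ by
    rw [map_pow]; exact pow_eq_pow_of_forall hθ0 (hθS τ hτ) hgmem
  -- ## 9. The new periods, in Castella's display
  obtain ⟨β, r, hr, hr1, hβ0, hβr⟩ : ∃ (β : PadicAlgCl p) (r : ℂ_[p]), r ∈ unrIntegers p ∧ ‖r‖ = 1 ∧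
      β ≠ 0 ∧ ∀ n ∈ S, ((β : ℂ_[p]) * r ^ 4) ^ n = θ ^ n := by
    rcases Nat.eq_zero_or_pos g with hg0 | hgpos
    · refine ⟨1, 1, one_mem _, norm_one, one_ne_zero, fun n hn ↦ ?_⟩
      have := hgS n hn
      rw [hg0, zero_dvd_iff] at this
      rw [this, pow_zero, pow_zero]
    · have hmem := mem_fracUnr_of_forall_inertia_fixed_family p T hT hTτ (θ ^ g) (hθg)
      obtain ⟨β, r, hr, hr1, hβr⟩ := exists_period_root
        (UnrUnits.forall_exists_padicAlgCl_mul_pow_of_norm_eq_one) hθ0 hgpos hmem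
      have hβ0 : β ≠ 0 := by
        intro h0
        rw [h0, PadicComplex.coe_eq, map_zero, zero_mul, zero_pow hgpos.ne'] at hβr
        exact pow_ne_zero g hθ0 hβr.symm
      exact ⟨β, r, hr, hr1, hβ0, fun n hn ↦ pow_eq_pow_of_dvd hβr (hgS n hn)⟩
  have hιβ : ι' β ≠ 0 := (map_ne_zero_iff _ ι'.injective).2 hβ0
  obtain ⟨ρ, hρ⟩ := IsAlgClosed.exists_pow_nat_eq (ι' β) (by norm_num : 0 < 4)
  have hρ0 : ρ ≠ 0 := by
    intro h0
    rw [h0, zero_pow (by norm_num : (4 : ℕ) ≠ 0)] at hρ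
    exact hιβ hρ.symm
  have hΩρ : Ω / (Ω / ρ) = ρ := by field_simp
  have hru : IsUnit (⟨r, hr⟩ : unrIntegers p) := (unrIntegers.isUnit_iff_norm_eq_one _).2 hr1
  refine ⟨Ω / ρ, hru.unit, L, div_ne_zero hΩ hρ0, fun χ n hn hunr hχ r' hr' hκr' ↦ ?_⟩
  rw [← IntSeries.hasValueAt_iff_of_coeff_eq hLE]
  have hv := hEval χ n hn hunr hχ r' hr' hκr'
  have hrr : (((hru.unit : (unrIntegers p)ˣ) : unrIntegers p) : ℂ_[p]) = r := by
    rw [IsUnit.unit_spec]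
  have htarget : ((ι'.symm (bdpInterpolationValue p f 𝔭 χ n (Ω / ρ)) : PadicAlgCl p) : ℂ_[p]) *
      (((hru.unit : (unrIntegers p)ˣ) : unrIntegers p) : ℂ_[p]) ^ (4 * n) =
      θ ^ n * ((ι'.symm (bdpInterpolationValue p f 𝔭 χ n Ω) : PadicAlgCl p) : ℂ_[p]) := by
    rw [bdpInterpolationValue_eq_mul_of_ne_zero p f 𝔭 χ n hΩ (Ω / ρ), hΩρ, pow_mul, hρ,
      coe_symm_mul, coe_symm_pow, ι'.symm_apply_apply, hrr]
    by_cases hB : bdpInterpolationValue p f 𝔭 χ n Ω = 0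
    · rw [hB, map_zero, PadicComplex.coe_zero, mul_zero, mul_zero, zero_mul]
    · have hnS : n ∈ S := ⟨χ, r', hn, hunr, hχ, hr', hκr', hB⟩
      rw [← hβr n hnS, mul_pow, ← pow_mul]
      ring
  rw [htarget]
  exact hv


end Core

end Summit.BirchSwinnertonDyer.BirchSwinnertonDyer.Theorems

end
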